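import Literature.NumberTheory.Automorphic.Liu2021.Prop413AsPrinted
import Literature.NumberTheory.Automorphic.Liu2021.Prop46AsPrinted
import Literature.NumberTheory.Automorphic.Liu2021.Def411AsPrinted
import Mathlib.Algebra.Category.ModuleCat.Basic
import HarnessLib

/-!
# Liu 2021, §4.2 «Albanese of unitary Shimura varieties», part I (print pp. 45–52, items 4.11–4.17) — SECTION CARPET
# (statement-exact typing of the items not yet typed: the admissibility sentence of p. 46, Remark 4.14, Definition 4.16,
# Remark 4.17; an INDEX of every item 4.11–4.17 to its tree declaration; no proof)

[Liu2021] = Yifeng Liu, *Fourier–Jacobi cycles and arithmetic relative trace formula* (with an appendix by Chao Li and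
Yihang Zhu), Cambridge J. Math. **9** (2021), no. 1, 1–147 = arXiv:2102.11518.  PRIMARY SOURCE READ FOR THIS FILE: the
PRINT text held as `paper:liu2021-fourier-jacobi-cycles-arithmetic-relative-trace-formula` (147 pp.; page file `pNNNN` =
journal page `N`; every «p. N Lk» below is a line of that materialisation), cross-checked against the TeX-line pins
(`FJcycle.tex`, md5 `6db49a74122d…`) quoted by the sibling AS-PRINTED records `Thm418AsPrinted`, `Prop413AsPrinted`,
`Prop46AsPrinted`, `Def411AsPrinted` (same directory).  Numbering of print = numbering of arXiv v2 (cell record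
`lit/PAGE-CONCORDANCE-Liu2021.md`: Def. 4.11 p. 46, Def. 4.12 p. 47, Prop. 4.13 p. 47, Rem. 4.14 p. 49, Thm. 4.15 p. 50,
Def. 4.16 p. 52, Rem. 4.17 p. 52; §4.2 opens p. 45 L45).

## What this file is

The squad-TL carpet of §4.2 up to Remark 4.17 (seat plan «GO 500» v1, deal sheet `SPLIT-TL.v1` row TL-t02).  §4.2 part I is
the most densely cited stretch of [Liu2021] in the tree (Def. 4.11: 133 files, Prop. 4.13: 59, Thm. 4.15: 70 carry the cite
tag), and four of its seven numbered items are already typed EXACTLY AS PRINTED by sibling records; those are CITED BY NAME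
in the INDEX below and NOT restated.  What was not yet typed as a declaration is typed here, over the SAME data
(`Prop413Data`, `Thm418Data`, the morphism carrier `𝒜` of `Prop46_1AsPrinted`) and in the same discipline («What a CARRIER
is», module docstring of `Thm418AsPrinted`): a ⟨CARRIER⟩ is a posited datum standing for a printed object Mathlib / the
tree cannot construct; every `def … : Prop` is a PREDICATE on the consumer's datum; NOTHING IS ASSERTED; `∀ D, P D` is
never the printed statement and is never claimed.
1. `H1BettiAdmissibleAsPrinted P` — the sentence «`H¹_{B,τ'}(A_∞, ℂ) := colim_K H¹_{B,τ'}(A_K, ℂ)`, which is an admissible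
   representation of `𝔾(𝔸_F^∞)`» (p. 46 L21–24), on the carrier `Prop413Data.rhoB` with the tree's `IsSmoothRep` /
   `IsAdmissibleRep` (READING I2 of `Def411AsPrinted`).
2. `Rem414AsPrinted P` — Remark 4.14 (p. 49 L35–36).
3. `Def416Data D 𝒜` (carriers) with `Def416AsPrinted X` — Definition 4.16 (p. 52 L1–19): `Ω(μ)` IS the colimit, in the
   category of `M_μ[𝔾(𝔸_F^∞)]`-modules, of `D_μ ↦ Hom_E(A_∞, A_μ)_ℚ` over `𝒜(μ)`.
4. `Rem417AsPrinted X` — Remark 4.17 (p. 52 L34–36): every canonical map `Hom_E(A_∞, A_μ)_ℚ → Ω(μ)` is an isomorphism.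

## INDEX — every item of §4.2 part I (pp. 45–52) ↦ its tree declaration(s)

(Namespaces: `L` = `Literature.NumberTheory.Automorphic.Liu2021`, `LC` = `L.AppendixC`, `AG` = `Literature.AlgebraicGeometry.Liu2021`.)
* **§4.2 standing data** (p. 45 L45 – p. 46 L15; TeX l. 2053–2074: `n ≥ 2`, `𝕍`, Noncompact / Compact Case, `𝔾 := U(𝕍)`,
  `Sh(𝕍)_K`, `X_K := \tilde Sh(𝕍)_K`, `u^{K'}_K`, `X_∞`, `A_K := Alb_{X_K}`, `α_K` (4.1), `{A_K}_K`, `A_∞`, the Hecke homomorphism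
  `𝔾(𝔸_F^∞) → Aut_E(A_∞)`) ↦ `LC.Sec42Data` (`AppendixC/Glue.lean`: `IsNoncompactCase`, `IsCompactCase`,
  `isProjectiveOver_iff_isCompactCase`, `X`, `A`, `albFunctor`, `HomQ`, `HomQ.pull`, `levelOf`), REAL over `LC.PropC5Data`;
  bare-carrier forms `L.Thm418Data.{n, two_le_n, 𝕍, G}`, `L.Prop413Data.{n, two_le_n, 𝕍, G}`, `AG.LiuAlbaneseDatum`.  NOT typed
  anywhere (recorded in `Glue.lean`): `X_∞` as an object, «generically finite dominant», `A_∞` as a pro-object (only its system).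
* **p. 46 L16–24** (TeX l. 2077–2081: Faltings reduction; «`H¹_{B,τ'}(A_∞, ℂ) := colim_K H¹_{B,τ'}(A_K, ℂ)`, which is an admissible
  representation of `𝔾(𝔸_F^∞)`») ↦ carrier `L.Prop413Data.HB τ'` / `rhoB τ'`; REAL tower `LC.Sec42Data.bettiH1Tower τ'` with
  `bettiHeckeRep` (`AppendixC/BettiH1Tower.lean`), `LC.Sec42Data.BettiPinning` (`EtaleBettiComparison.lean`); the ADMISSIBILITY clause
  ↦ `H1BettiAdmissibleAsPrinted` (THIS FILE, item 1).
* **Definition 4.11** (p. 46 L32–47; adèlic oscillator triple `(μ, ε, χ)`, `ω(μ, ε, χ) := ⊗'_v ω(μ_v, ε_v, χ_v)` «irreducible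
  admissible») ↦ `L.Def411AsPrinted` (+ `IsIrreducibleOrZero`, `IsSmoothRep`, `IsAdmissibleRep`, `Def411AsPrinted.lean`); data
  `L.Prop413Data.Triple`, carriers `L.Thm418Data.{Eps, Chi, omega, rho}`, `L.Prop413Data.{omega, rho}`; REAL `μ : IdeleClassGroup E →ₜ* Circle`
  with `IdeleClassGroup.IsConjugateSymplectic` (Def. 4.1); local factors `Literature.RepresentationTheory.Liu2021.LocalOscillator*` (App. D §D.1);
  bare form `AG.LiuAlbaneseDatum.{Char, Adm, Rep, omega}`.
* **Definition 4.12** (p. 47 L1–9; «`ε` is `μ`-admissible»; «`ε` is `μ`-admissible iff `−ε` is `μ^c`-admissible») ↦ `AG.IsAdmissibleElement`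
  with `isAdmissibleElement_conj_neg_iff`, `exists_isAdmissibleElement` (`AlgebraicGeometry/Liu2021/AdmissibleElement.lean`);
  `L.Thm418Data.IsAdmissible`, `L.Prop413Data.Triple.IsAdmissible`, `L.Thm418Data.AdmIndex`, `L.Prop413Data.AdmTriple`; parity reading
  `L.isAdmissible_epsOf_iff_even` (`Def412AdmissibleIffParity.lean`); rescaling `Def411AdmissibleRescaling.lean`.
* **Proposition 4.13** (p. 47 L10–17; «Suppose that `n ≥ 3` … `H¹_{B,τ'}(A_∞, ℂ) ≃ ⊕_{(μ,ε,χ)} ω(μ, ε, χ)`») ↦ `L.Prop413AsPrinted`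
  (module isomorphism, `Prop413AsPrinted.lean`; bridge `L.Prop413Data.Rest418` / `toThm418Data`); pinned at the tower
  `LC.UniformOmega.prop413Data` (`AppendixC/Prop413DataOfTower.lean`, `Prop413DataOfRestOne.lean`); multiplicity forms
  `L.Prop413Data.MultOneAsPrinted`, `L.Prop413Data.multiplicity_le_one_printed`, `AG.LiuAlbaneseDatum.Prop413`; its proof's
  dictionary (p. 47 L18 – p. 49 L34) `Literature.NumberTheory.GelbartRogawski1991.oscillatorTriple_dictionary`.
* **Remark 4.14** (p. 49 L35–36) ↦ `Rem414AsPrinted` (THIS FILE, item 2); the [GR91] reading it names ↦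
  `Literature.NumberTheory.GelbartRogawski1991.{oscillatorTriple_dictionary, muAdmissible_iff_multiplicity_one}`.
* **p. 49 L37 – p. 50 L23** (TeX l. 2152–2174, un-numbered: the comparison isomorphism `H¹_ét(A_K ⊗_{E,τ'} ℂ, ℚ_ℓ^{ac}) ≃ H¹_{B,τ'}(A_K, ℂ)
  ⊗_{ℂ,ι_ℓ} ℚ_ℓ^{ac}`, `H¹_ét(A_∞ ⊗_{E,τ'} ℂ, ℚ_ℓ^{ac}) := colim_K`, a `ℚ_ℓ^{ac}[Gal(ℂ/τ'(E)) × 𝔾(𝔸_F^∞)]`-module; the Hom-space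
  `Hom_{ℚ_ℓ^{ac}[𝔾(𝔸_F^∞)]}(ι_ℓ ∘ ω(μ,ε,χ), H¹_ét(A_∞ ⊗ ℂ, ℚ_ℓ^{ac}))`, «by Proposition 4.13 … an `ℓ`-adic character» `ρ_{τ',ι_ℓ}(μ,ε,χ)`,
  the induced automorphic character `ρ_{τ',ℓ}(μ,ε,χ)`, its independence of `ι_ℓ`) ↦ REAL tower `LC.Sec42Data.etaleH1Tower ℓ` with
  `towerRep` (Galois action) and `LC.Sec42Data.EtaleHeckeDatum` (Hecke action), `LC.Sec42Data.BettiComparison`,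
  `LC.exists_h1ComparisonFamily` (the comparison theorem, named fact), the Hom-space `LC.Sec42Data.EtaleHeckeDatum.omegaHom`
  (`AppendixC/EtaleH1Tower.lean`, `EtaleBettiComparison.lean`, `Thm415Pinned.lean`).  NOT typed anywhere: «such representation is an
  `ℓ`-adic character» as a rank statement (a consequence of Prop. 4.13, deliberately not vendored — `Thm415Pinned.lean` module
  docstring), `ρ_{τ',ℓ}` as an AUTOMORPHIC character and its independence of `ι_ℓ` (no Artin map is applied in the tree's edition).
* **Theorem 4.15** (p. 50 L24–28; «`ρ_{τ',ℓ}(μ,ε,χ) ∘ τ' = μ^{alg}` for every `τ' ∈ Φ_μ` and every rational prime `ℓ`») ↦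
  `LC.Thm415Pinned` (named fact, `Thm415Pinned.lean`) with `LC.thm415Pinned_of_frobenius` (`Thm415PinnedOfFrobenius.lean`); bare form
  `AG.LiuAlbaneseCMDatum.Thm415`; `μ^{alg}`, `M_μ` (Def. 4.3 ff., p. 41) ↦ `L.muAlgValue`, `L.fieldOfValues`, `IdeleClassGroup.muAlgValueField`.
* **Definition 4.16** (p. 52 L1–19) ↦ `Def416Data`, `Def416AsPrinted` (THIS FILE, item 3); carrier `L.Thm418Data.Ω` / `rhoΩ`,
  `L.Prop413Data.Rest418.Ω`; REAL `Hom_E(A_∞, B)_ℚ = colim_K ℚ ⊗ Hom_E(A_K, B)` over the levels ↦ `LC.RestOne.ΩOf` / `resOf`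
  (`AppendixC/RestOne.lean`), «`M_μ` acts via `i_μ`» ↦ `LC.RestOne.EndScalar` / `moduleQHom`.
* **Remark 4.17** (p. 52 L34–36) ↦ `Rem417AsPrinted` (THIS FILE, item 4); used as the identification `Ω(μ) = Hom_E(A_∞, A_μ)_ℚ` in
  `L.Thm418Data.Map43Data` (`Thm418ProofMapAsPrinted.lean`) and `LC.RestOne.restOne` (the one-object presentation).
(Theorem 4.18, p. 52 L37 ff., opens part II: `L.Thm418AsPrinted`; squad file `Sec42AlbaneseUnitaryShimuraII.lean`.)

## The printed text of the items typed here (verbatim; `\bG` = `𝔾`, `\bA` = `𝔸`, `\cA(\mu)` = `𝒜(μ)`)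

**p. 46 L16–24** (TeX l. 2077–2081): «To study isogeny factors of `A_K`, it suffices to study the `L`-function of
`H¹_{ét}((A_K)_{E^{ac}}, ℚ^{ac}_ℓ)` by Faltings' isogeny theorem. We start from describing its Betti cohomology `H¹_{B,τ'}(A_K, ℂ)`.
For every embedding `τ' : E → ℂ`, put `H¹_{B,τ'}(A_∞, ℂ) := lim_K H¹_{B,τ'}(A_K, ℂ)`, which is an admissible representation of
`𝔾(𝔸_F^∞)`.»
**Remark 4.14** (p. 49 L35–36; TeX l. 2148–2150): «When `n = 3`, Proposition 4.13 can be deduced from [GR91, Rog92].»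
([GR91] = `GelbartRogawski1991`, [Rog92] = `Rogawski1992` in `references.bib`.)
**Definition 4.16** (p. 52 L1–19; TeX l. 2218–2224): «Let `μ : E^× \ 𝔸_E^× → ℂ^×` be a conjugate symplectic character of weight one.
For every object `D_μ = (A_μ, i_μ, λ_μ, r_μ) ∈ 𝒜(μ)` (Definition 4.5), the `ℚ`-vector space `Hom_E(A_∞, A_μ)_ℚ` is an
`M_μ[𝔾(𝔸_F^∞)]`-module, where `M_μ` acts via `i_μ` and `𝔾(𝔸_F^∞)` acts `M_μ`-linearly via its action on `A_∞`. Put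
`Ω(μ) := lim_{→, D_μ ∈ 𝒜(μ)} Hom_E(A_∞, A_μ)_ℚ` in the category of `M_μ[𝔾(𝔸_F^∞)]`-modules.»
**Remark 4.17** (p. 52 L34–36; TeX l. 2226–2228): «It follows from Proposition 4.6(1) that for every object
`D_μ = (A_μ, i_μ, λ_μ, r_μ) ∈ 𝒜(μ)`, the canonical map `Hom_E(A_∞, A_μ)_ℚ → Ω(μ)` is an isomorphism.»
Context used: Def. 4.5 (3) (p. 42 L33–37): morphisms of `𝒜(μ)` «are isogenies `φ : A_μ → A'_μ` satisfying `φ ∘ i_μ(x) = i'_μ(x) ∘ φ`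
for every `x ∈ M_μ`, …»; Prop. 4.6 (1) (p. 43 L1): «The category `𝒜(μ)` is a nonempty and connected partially ordered set.»

## The typing (paper order) and its READINGS

* Item 1.  «admissible representation of `𝔾(𝔸_F^∞)`» = smooth ∧ admissible (READING I2 of `Def411AsPrinted`, the standard meaning
  for a totally disconnected locally compact group), on `P.rhoB τ'` for EVERY `τ'` (as printed: «For every embedding `τ'`»).
* Item 2.  Remark 4.14 is a PROVENANCE sentence; its mathematical content — Proposition 4.13 holds when `n = 3` — is typed as
  `P.n = 3 →` (the conclusion of `Prop413AsPrinted P`, token for token); the provenance ([GR91, Rog92]) is recorded in the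
  docstring, not typed (READING M1): literally `P.n = 3 → Prop413AsPrinted P`.
* Item 3.  Over `D : Thm418Data F E` (its REAL `μ` conjugate symplectic of weight one = the hypothesis sentence of Def. 4.16; its
  carriers `Obj` = objects of `𝒜(μ)`, `Ω` / `rhoΩ` = `Ω(μ)` with its `M_μ[𝔾(𝔸_F^∞)]`-structure, `M_μ = fieldOfValues E D.μ`) and the
  morphism carrier `𝒜 : SmallCategory D.Obj` of `Prop46_1AsPrinted` (Def. 4.5 (3)), the structure `Def416Data D 𝒜` posits:
  ⟨CARRIER⟩ `HomInf D_μ` = the `M_μ`-module `Hom_E(A_∞, A_μ)_ℚ` («`M_μ` acts via `i_μ`»; an object of Mathlib's `ModuleCat M_μ`),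
  ⟨CARRIER⟩ `rhoInf D_μ` = its `M_μ`-linear `𝔾(𝔸_F^∞)`-action («acts `M_μ`-linearly via its action on `A_∞`»), ⟨CARRIER⟩ `map φ` =
  `f ↦ φ ∘ f` for a morphism `φ : D_μ → D'_μ` of `𝒜(μ)` (an isogeny commuting with the `M_μ`-actions, Def. 4.5 (3) — hence
  `M_μ`-linear; it is `𝔾`-equivariant because `𝔾` acts on the source `A_∞`: ⟨CARRIER LAW⟩s `map_id`, `map_comp`, `map_rhoInf`,
  READING C1: «`lim_{→, D_μ ∈ 𝒜(μ)}`» is the colimit of this FUNCTOR on `𝒜(μ)`), and ⟨CARRIER⟩ `can D_μ : Hom_E(A_∞, A_μ)_ℚ → Ω(μ)` = «the canonical map» of Rem. 4.17 (the colimit leg).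
  `Def416AsPrinted X` := (`Ω(μ)`, `can`) is a COLIMIT COCONE of that functor in the category of `M_μ[𝔾(𝔸_F^∞)]`-modules: the legs are
  compatible with `map` and `𝔾`-equivariant, and every other compatible equivariant family into an `M_μ[𝔾(𝔸_F^∞)]`-module `W`
  factors through a UNIQUE `𝔾`-equivariant `M_μ`-linear `Ω(μ) → W` (READING C2: the universal property, stated explicitly over
  `M_μ`-modules-with-`𝔾`-action rather than through Mathlib's `Rep` category — the same mathematical content, auditable field by
  field; test objects `W : Type`, the universe of `Ω(μ)`).
* Item 4.  «is an isomorphism» (of `M_μ[𝔾(𝔸_F^∞)]`-modules) = the `M_μ`-linear, equivariant (by item 3) map `can D_μ` is BIJECTIVE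
  (READING C3; `canEquiv` packages it as a linear equivalence).  The printed justification «It follows from Proposition 4.6(1)»
  (all transition maps are isomorphisms, the index category is nonempty and connected — `Prop46_1AsPrinted D 𝒜`) is NOT proved here.
  ED.2 (2026-09-02, TL-plan ruling 02:37:00Z SHOULD on T-ref2's (c) STRENGTH PASS; every other declaration byte-identical):
  `Def416Data` gains the LEVEL PRESENTATION of `Hom_E(A_∞, A_μ)_ℚ` — READING C4: since «`A_∞ := lim_K A_K` … is an abelian group
  pro-object in `Sch_{/E}`» (p. 46 L17–21), `Hom_E(A_∞, A_μ)_ℚ` is the directed colimit `colim_K Hom_E(A_K, A_μ)_ℚ` over the sufficiently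
  small open compact levels (as the tree CONSTRUCTS it over the Appendix-C datum: `AppendixC.RestOne.ΩOf`, a `Module.DirectLimit`); the
  structure now carries a REAL small level `K₀`, ⟨CARRIER⟩ transition maps `pull` on the tree's `Thm418Data.HomK K D_μ` and legs `incl`, the
  ⟨CARRIER LAW⟩s making `(HomInf D_μ, incl)` that colimit elementwise (`incl_pull`, `incl_jointly_surjective`, `incl_eq_iff`), and the pin
  `can_incl : can ∘ incl_K = Thm418Data.res K` («the canonical map `Hom_E(A_K, A_μ)_ℚ → Hom_E(A_∞, A_μ)_ℚ → Ω(μ)`», the reading R5 of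
  `Thm418AsPrinted`).  So Def. 4.16 ∕ Rem. 4.17 now speak about the tree's level groups and `res`, not about a free module.
No hypothesis is added and none dropped; I2, M1, C1–C4 are the only interpretive choices.  NO PROOF (statements only).
Non-vacuity of the binder lists (trivial carriers over a REAL weight-one conjugate symplectic `μ`, which EXISTS by the tree's
`IdeleClassGroup.exists_isConjugateSymplectic_hasCMType`) is checked in the seat's scratch file (squad folder
`T/LIU/TL-t02/g0/Sec42I_full_with_nonvacuity.lean`, not shipped: this file is statements only).

## NOT here

Theorem 4.18 ff. (part II); the instantiation of `Def416Data` on the REAL presentation `LC.RestOne.ΩOf` of `Hom_E(A_∞, A_μ)_ℚ` (ED.2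
pins its SHAPE — colimit of the level groups — not that instance); the `M_μ`- and `𝔾(𝔸_F^∞)`-structures at finite level (the tree's
`Thm418Data.HomK` is a bare additive group); Prop. 4.6 (2) (`𝒜(μ)^{op} ≃ 𝒜(μ^c)`); proofs.

## References

* [Liu2021] Y. Liu, *Fourier–Jacobi cycles and arithmetic relative trace formula*, Camb. J. Math. 9 (2021) 1–147, arXiv:2102.11518 —
  §4.2 pp. 45–52: standing data p. 45–46, Def. 4.11 (p. 46), Def. 4.12 (p. 47), Prop. 4.13 (p. 47), Rem. 4.14 (p. 49), l-adic set-up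
  pp. 49–50, Thm. 4.15 (p. 50), Def. 4.16 (p. 52), Rem. 4.17 (p. 52); Def. 4.5 (3) (p. 42), Prop. 4.6 (1) (p. 43).
* [GelbartRogawski1991] S. Gelbart, J. Rogawski, *L-functions and Fourier–Jacobi coefficients for the unitary group U(3)*, Invent.
  Math. 105 (1991); [Rogawski1992] J. Rogawski, *The multiplicity formula for A-packets* (1992) — the sources Remark 4.14 names.
-/

noncomputable section

open NumberField CategoryTheory DirectSum

namespace Literature.NumberTheory.Automorphic.Liu2021.Sec42AlbaneseUnitaryShimuraI

variable {F E : Type} [Field F] [NumberField F] [IsTotallyReal F] [Field E] [NumberField E] [Algebra F E]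
  [IsTotallyComplex E] [Algebra.IsQuadraticExtension F E]

/-! ## Item 1 (p. 46 L21–24): `H¹_{B,τ'}(A_∞, ℂ)` is an admissible representation of `𝔾(𝔸_F^∞)` -/

/-- **[Liu2021, §4.2, p. 46 L21–24] AS PRINTED** (TeX l. 2079–2081), for the datum `P` of `Prop413AsPrinted` (standing hypotheses:
`F` totally real, `E/F` totally imaginary quadratic — the instance arguments; `n ≥ 2`, `𝕍`, `G = 𝔾(𝔸_F^∞)`; ⟨CARRIER⟩ `P.HB τ'` with
its action `P.rhoB τ'` = «`H¹_{B,τ'}(A_∞, ℂ) := colim_K H¹_{B,τ'}(A_K, ℂ)`»):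

«For every embedding `τ' : E → ℂ`, put `H¹_{B,τ'}(A_∞, ℂ) := lim_K H¹_{B,τ'}(A_K, ℂ)`, which is an admissible representation of
`𝔾(𝔸_F^∞)`.»

TYPED: for every `τ' : E →+* ℂ`, `P.rhoB τ'` is smooth and admissible (READING I2 of `Def411AsPrinted`: `IsSmoothRep` — every vector
is fixed by an open subgroup — and `IsAdmissibleRep` — finite-dimensional `K`-fixed vectors for every open compact `K`).  A consumer
takes `(h : H1BettiAdmissibleAsPrinted P)` for ITS OWN `P`; `∀ P, …` is not claimed.  NO PROOF.
[cite: Liu2021, §4.2 (p. 46 L21–24)] -/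
def H1BettiAdmissibleAsPrinted (P : Prop413Data F E) : Prop :=
  ∀ τ' : E →+* ℂ, IsSmoothRep (P.rhoB τ') ∧ IsAdmissibleRep (P.rhoB τ')

/-! ## Item 2: Remark 4.14 (p. 49 L35–36) -/

/-- **[Liu2021, Remark 4.14] AS PRINTED** (p. 49 L35–36; TeX l. 2148–2150), for the datum `P` of `Prop413AsPrinted`:

«When `n = 3`, Proposition 4.13 can be deduced from [GR91, Rog92].»

TYPED (READING M1): the remark is a provenance statement; its mathematical content is the case `n = 3` of Proposition 4.13 —
`P.n = 3 → Prop413AsPrinted P`, literally (the conclusion of `Prop413AsPrinted P` — for every embedding `τ' : E → ℂ` an isomorphism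
`H¹_{B,τ'}(A_∞, ℂ) ≃ ⊕_{(μ,ε,χ)} ω(μ, ε, χ)` of `ℂ[𝔾(𝔸_F^∞)]`-modules over the adèlic oscillator triples with `μ` of weight one and `ε`
`μ`-admissible — under its own antecedent `3 ≤ n`, which `n = 3` discharges).  The provenance — [GR91] = S. Gelbart, J. Rogawski,
Invent. Math. 105 (1991) (`GelbartRogawski1991`; its reading is the tree's `GelbartRogawski1991.oscillatorTriple_dictionary`) and
[Rog92] = J. Rogawski, *The multiplicity formula for A-packets* (`Rogawski1992`) — is not a mathematical clause and is not typed.  A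
consumer takes `(h : Rem414AsPrinted P)` for ITS OWN `P`.  NO PROOF. [cite: Liu2021, Rem. 4.14 (p. 49)] -/
def Rem414AsPrinted (P : Prop413Data F E) : Prop :=
  P.n = 3 → Liu2021.Prop413AsPrinted P

/-! ## Item 3: Definition 4.16 (p. 52 L1–19) — `Ω(μ)` is the colimit of `D_μ ↦ Hom_E(A_∞, A_μ)_ℚ` over `𝒜(μ)` -/

/-- **The data of [Liu2021, Definition 4.16] beyond `Thm418Data`** (p. 52 L1–19; TeX l. 2218–2224), for the datum `D` of
`Thm418AsPrinted` — whose REAL `D.μ` with `D.isConjugateSymplectic`, `D.hasWeight_one` is the hypothesis «Let `μ` … be a conjugate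
symplectic character of weight one», whose ⟨CARRIER⟩ `D.Obj` are the objects `D_μ = (A_μ, i_μ, λ_μ, r_μ)` of `𝒜(μ)` (Def. 4.5) and
whose ⟨CARRIER⟩ `D.Ω`, `D.rhoΩ` is `Ω(μ)` with its `M_μ[𝔾(𝔸_F^∞)]`-structure, `M_μ = fieldOfValues E D.μ` — and for the ⟨CARRIER⟩ `𝒜`
= the morphisms of `𝒜(μ)` (Def. 4.5 (3), p. 42 L33–37: «isogenies `φ : A_μ → A'_μ` satisfying `φ ∘ i_μ(x) = i'_μ(x) ∘ φ` for every
`x ∈ M_μ`, …», as in `Prop46_1AsPrinted D 𝒜`; `𝒜.Hom D_μ D'_μ` is the type of such `φ`).  ED.2 (TL-plan 02:37:00Z SHOULD, T-ref2 (c)):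
`Hom_E(A_∞, A_μ)_ℚ` is no longer free but for functoriality — it is PINNED as the colimit of the tree's level groups `D.HomK K D_μ =
Hom_E(A_K, A_μ)_ℚ` along posited transition maps `pull` (legs `incl`, laws `incl_pull`, `incl_jointly_surjective`, `incl_eq_iff` over the
open compact levels below a REAL sufficiently small `K₀`), and the tree's `D.res K D_μ` is pinned as `can ∘ incl` (`can_incl`); the REAL
presentation over the Appendix-C datum is the tree's `AppendixC.RestOne.ΩOf` (a `Module.DirectLimit`).  Printed sentence: «For every object
`D_μ = (A_μ, i_μ, λ_μ, r_μ) ∈ 𝒜(μ)` (Definition 4.5), the `ℚ`-vector space `Hom_E(A_∞, A_μ)_ℚ` is an `M_μ[𝔾(𝔸_F^∞)]`-module, where `M_μ`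
acts via `i_μ` and `𝔾(𝔸_F^∞)` acts `M_μ`-linearly via its action on `A_∞`.»  Fields marked ⟨CARRIER⟩ / ⟨CARRIER LAW⟩ are posited;
nothing is asserted by this structure. [cite: Liu2021, Def. 4.16 (p. 52)] -/
structure Def416Data (D : Thm418Data F E) (𝒜 : SmallCategory D.Obj) : Type 1 where
  /-- ⟨CARRIER⟩ the `M_μ`-module `Hom_E(A_∞, A_μ)_ℚ` for the object `D_μ` with abelian variety `A_μ` («the `ℚ`-vector space
  `Hom_E(A_∞, A_μ)_ℚ` … where `M_μ` acts via `i_μ`», p. 52 L3–5; `Hom_E(A_∞, B)_ℚ = colim_K Hom_E(A_K, B)_ℚ`, REAL in the tree as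
  `AppendixC.RestOne.ΩOf`). -/
  HomInf : D.Obj → ModuleCat.{0} (fieldOfValues E D.μ)
  /-- ⟨CARRIER⟩ «`𝔾(𝔸_F^∞)` acts `M_μ`-linearly via its action on `A_∞`» (p. 52 L5–6): the action of `D.G = 𝔾(𝔸_F^∞)` on
  `Hom_E(A_∞, A_μ)_ℚ` by `M_μ`-linear maps (through «the Hecke correspondences … `𝔾(𝔸_F^∞) → Aut_E(A_∞)`», p. 46 L14–15). -/
  rhoInf : ∀ a, Representation (fieldOfValues E D.μ) D.G (HomInf a)
  /-- ⟨CARRIER⟩ the transition map `f ↦ φ ∘ f : Hom_E(A_∞, A_μ)_ℚ → Hom_E(A_∞, A'_μ)_ℚ` along a morphism `φ : D_μ → D'_μ` of `𝒜(μ)`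
  (an isogeny `A_μ → A'_μ` with `φ ∘ i_μ(x) = i'_μ(x) ∘ φ`, Def. 4.5 (3) — hence `M_μ`-linear). -/
  map : ∀ {a b : D.Obj}, 𝒜.Hom a b → (HomInf a →ₗ[fieldOfValues E D.μ] HomInf b)
  /-- ⟨CARRIER LAW⟩ functoriality: the identity isogeny acts as the identity. -/
  map_id : ∀ a : D.Obj, map (𝒜.id a) = LinearMap.id
  /-- ⟨CARRIER LAW⟩ functoriality: composition of isogenies acts as composition (`𝒜.comp φ ψ` = `φ` then `ψ`). -/
  map_comp : ∀ {a b c : D.Obj} (φ : 𝒜.Hom a b) (ψ : 𝒜.Hom b c), map (𝒜.comp φ ψ) = map ψ ∘ₗ map φ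
  /-- ⟨CARRIER LAW⟩ `f ↦ φ ∘ f` commutes with the action of `𝔾(𝔸_F^∞)`, which is on the source `A_∞`. -/
  map_rhoInf : ∀ {a b : D.Obj} (φ : 𝒜.Hom a b) (g : D.G) (x : HomInf a), map φ (rhoInf a g x) = rhoInf b g (map φ x)
  /-- ⟨CARRIER⟩ «the canonical map `Hom_E(A_∞, A_μ)_ℚ → Ω(μ)`» (Rem. 4.17, p. 52 L35–36): the leg of the colimit at `D_μ`. -/
  can : ∀ a : D.Obj, HomInf a →ₗ[fieldOfValues E D.μ] D.Ω
  /-- REAL datum (ED.2): a sufficiently small open compact level `K₀ ⊆ 𝔾(𝔸_F^∞)` («indexed by sufficiently small open compact subgroups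
  `K`», p. 45 L50 – p. 46 L7), below which the tree's level groups `D.HomK K D_μ = Hom_E(A_K, A_μ)_ℚ` are meaningful. -/
  K₀ : Subgroup D.G
  /-- `K₀` is open compact (the tree's `IsOpenCompact`). -/
  isOpenCompact_K₀ : IsOpenCompact K₀
  /-- ⟨CARRIER⟩ (ED.2) the transition maps of the projective system `{A_K}_K` on Hom spaces, `f ↦ f ∘ u` along `A_{K'} → A_K` for
  `K' ≤ K` («By functoriality, we obtain a projective system `{A_K}_K`», p. 46 L16, (4.1)), on the tree's groups `D.HomK K D_μ`. -/
  pull : ∀ {K K' : Subgroup D.G} (a : D.Obj), K' ≤ K → (D.HomK K a →+ D.HomK K' a)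
  /-- ⟨CARRIER⟩ (ED.2) the canonical map `Hom_E(A_K, A_μ)_ℚ → Hom_E(A_∞, A_μ)_ℚ` of the level `K` — composition with the projection
  `A_∞ → A_K` of «`A_∞ := lim_K A_K`, which is an abelian group pro-object in `Sch_{/E}`» (p. 46 L17–21): the leg at `K` of the
  direct system whose colimit `Hom_E(A_∞, A_μ)_ℚ` IS (READING C4). -/
  incl : ∀ (K : Subgroup D.G) (a : D.Obj), D.HomK K a →+ HomInf a
  /-- ⟨CARRIER LAW⟩ (ED.2) the legs are compatible with the transition maps (open compact levels below `K₀`). -/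
  incl_pull : ∀ {K K' : Subgroup D.G} (a : D.Obj), IsOpenCompact K → K ≤ K₀ → IsOpenCompact K' → ∀ (h : K' ≤ K)
    (x : D.HomK K a), incl K' a (pull a h x) = incl K a x
  /-- ⟨CARRIER LAW⟩ (ED.2; READING C4: `Hom_E(A_∞, A_μ)_ℚ = colim_K Hom_E(A_K, A_μ)_ℚ`, `A_∞` being a pro-object, p. 46 L17–21) every
  element of `Hom_E(A_∞, A_μ)_ℚ` comes from some open compact level `K ≤ K₀` … -/
  incl_jointly_surjective : ∀ (a : D.Obj) (y : HomInf a),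
    ∃ K : Subgroup D.G, IsOpenCompact K ∧ K ≤ K₀ ∧ ∃ x : D.HomK K a, incl K a x = y
  /-- ⟨CARRIER LAW⟩ (ED.2; READING C4) … and two elements of an open compact level `K ≤ K₀` have the same image in `Hom_E(A_∞, A_μ)_ℚ`
  iff they agree at some open compact level `K' ≤ K` (the kernel relation of a directed colimit of abelian groups). -/
  incl_eq_iff : ∀ {K : Subgroup D.G} (a : D.Obj), IsOpenCompact K → K ≤ K₀ → ∀ x x' : D.HomK K a,
    incl K a x = incl K a x' ↔ ∃ K' : Subgroup D.G, IsOpenCompact K' ∧ ∃ h : K' ≤ K, pull a h x = pull a h x'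
  /-- ⟨CARRIER LAW⟩ (ED.2 pin to the tree's `Thm418Data.res`): «the canonical map `Hom_E(A_K, A_μ)_ℚ → Hom_E(A_∞, A_μ)_ℚ → Ω(μ)`» — the
  datum's `D.res K D_μ` IS `can_{D_μ} ∘ incl_K` (open compact `K ≤ K₀`). -/
  can_incl : ∀ (K : Subgroup D.G) (a : D.Obj), IsOpenCompact K → K ≤ K₀ → ∀ x : D.HomK K a, can a (incl K a x) = D.res K a x

namespace Def416Data

variable {D : Thm418Data F E} {𝒜 : SmallCategory D.Obj} (X : Def416Data D 𝒜)

/-- **A cocone in the category of `M_μ[𝔾(𝔸_F^∞)]`-modules** under the diagram `D_μ ↦ Hom_E(A_∞, A_μ)_ℚ` (READING C1/C2): an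
`M_μ`-module `W` with an `M_μ`-linear `𝔾(𝔸_F^∞)`-action `ρW` and `M_μ`-linear maps `c D_μ : Hom_E(A_∞, A_μ)_ℚ → W` that are compatible
with the transition maps (`c_{D'_μ} ∘ (φ ∘ –) = c_{D_μ}`) and `𝔾(𝔸_F^∞)`-equivariant. [cite: Liu2021, Def. 4.16 (p. 52)] -/
def IsCocone (W : Type) [AddCommGroup W] [Module (fieldOfValues E D.μ) W]
    (ρW : Representation (fieldOfValues E D.μ) D.G W) (c : ∀ a : D.Obj, X.HomInf a →ₗ[fieldOfValues E D.μ] W) : Prop :=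
  (∀ {a b : D.Obj} (φ : 𝒜.Hom a b), c b ∘ₗ X.map φ = c a) ∧
    ∀ (a : D.Obj) (g : D.G) (x : X.HomInf a), c a (X.rhoInf a g x) = ρW g (c a x)

end Def416Data

/-- **[Liu2021, Definition 4.16] AS PRINTED** (p. 52 L1–19; TeX l. 2218–2224), for the datum `D` of `Thm418AsPrinted`, the morphism
carrier `𝒜` of `𝒜(μ)` and the Hom-space carriers `X : Def416Data D 𝒜`:

«Let `μ : E^× \ 𝔸_E^× → ℂ^×` be a conjugate symplectic character of weight one. For every object `D_μ = (A_μ, i_μ, λ_μ, r_μ) ∈ 𝒜(μ)`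
(Definition 4.5), the `ℚ`-vector space `Hom_E(A_∞, A_μ)_ℚ` is an `M_μ[𝔾(𝔸_F^∞)]`-module, where `M_μ` acts via `i_μ` and `𝔾(𝔸_F^∞)`
acts `M_μ`-linearly via its action on `A_∞`. Put `Ω(μ) := lim_{→, D_μ ∈ 𝒜(μ)} Hom_E(A_∞, A_μ)_ℚ` in the category of
`M_μ[𝔾(𝔸_F^∞)]`-modules.»

TYPED (READINGS C1–C2): the datum's `Ω(μ)` (`D.Ω` with `D.rhoΩ`) together with the canonical maps `X.can D_μ` IS a colimit of the
functor `D_μ ↦ Hom_E(A_∞, A_μ)_ℚ` on `𝒜(μ)` in the category of `M_μ[𝔾(𝔸_F^∞)]`-modules: (i) `(Ω(μ), can)` is a cocone (legs compatible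
with the transition maps and `𝔾(𝔸_F^∞)`-equivariant), and (ii) for every cocone `(W, ρW, c)` there is a UNIQUE `𝔾(𝔸_F^∞)`-equivariant
`M_μ`-linear map `u : Ω(μ) → W` with `u ∘ can_{D_μ} = c_{D_μ}` for all `D_μ`.  No hypothesis added, none dropped.  A consumer takes
`(h : Def416AsPrinted X)` for ITS OWN `D`, `𝒜`, `X`; `∀ X, Def416AsPrinted X` is not claimed (false on degenerate carriers).  NO PROOF.
[cite: Liu2021, Def. 4.16 (p. 52)] -/
def Def416AsPrinted {D : Thm418Data F E} {𝒜 : SmallCategory D.Obj} (X : Def416Data D 𝒜) : Prop :=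
  X.IsCocone D.Ω D.rhoΩ X.can ∧
    ∀ (W : Type) [AddCommGroup W] [Module (fieldOfValues E D.μ) W] (ρW : Representation (fieldOfValues E D.μ) D.G W)
      (c : ∀ a : D.Obj, X.HomInf a →ₗ[fieldOfValues E D.μ] W), X.IsCocone W ρW c →
      ∃! u : D.Ω →ₗ[fieldOfValues E D.μ] W,
        (∀ (g : D.G) (y : D.Ω), u (D.rhoΩ g y) = ρW g (u y)) ∧ ∀ a : D.Obj, u ∘ₗ X.can a = c a

/-! ## Item 4: Remark 4.17 (p. 52 L34–36) -/

/-- **[Liu2021, Remark 4.17] AS PRINTED** (p. 52 L34–36; TeX l. 2226–2228), for the same `D`, `𝒜`, `X` as `Def416AsPrinted`: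

«It follows from Proposition 4.6(1) that for every object `D_μ = (A_μ, i_μ, λ_μ, r_μ) ∈ 𝒜(μ)`, the canonical map
`Hom_E(A_∞, A_μ)_ℚ → Ω(μ)` is an isomorphism.»

TYPED (READING C3): for every object `D_μ`, the canonical map `X.can D_μ` (an `M_μ`-linear map, `𝔾(𝔸_F^∞)`-equivariant under
`Def416AsPrinted X`) is bijective — i.e. an isomorphism of `M_μ[𝔾(𝔸_F^∞)]`-modules (`canEquiv`).  The printed justification (Prop. 4.6 (1):
`𝒜(μ)` nonempty, connected, thin — `Prop46_1AsPrinted D 𝒜` — and all transition maps are isomorphisms) is not reproduced.  A consumer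
takes `(h : Rem417AsPrinted X)` for ITS OWN data.  NO PROOF. [cite: Liu2021, Rem. 4.17 (p. 52)] -/
def Rem417AsPrinted {D : Thm418Data F E} {𝒜 : SmallCategory D.Obj} (X : Def416Data D 𝒜) : Prop :=
  ∀ a : D.Obj, Function.Bijective (X.can a)

namespace Def416Data

variable {D : Thm418Data F E} {𝒜 : SmallCategory D.Obj} {X : Def416Data D 𝒜}

/-- Under Remark 4.17, the identification `Hom_E(A_∞, A_μ)_ℚ ≃ Ω(μ)` at the object `D_μ` as an `M_μ`-linear equivalence («identify
`Ω(μ)` with `Hom_E(A_∞, A_μ)_ℚ` by Remark 4.17», proof of Thm. 4.18, p. 52 L43–44). [cite: Liu2021, Rem. 4.17 (p. 52)] -/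
def canEquiv (h : Rem417AsPrinted X) (a : D.Obj) : X.HomInf a ≃ₗ[fieldOfValues E D.μ] D.Ω :=
  LinearEquiv.ofBijective (X.can a) (h a)

/-- `canEquiv` is the canonical map. Unfolding, ours. [cite: Liu2021, Rem. 4.17 (p. 52)] -/
theorem canEquiv_apply (h : Rem417AsPrinted X) (a : D.Obj) (x : X.HomInf a) : canEquiv h a x = X.can a x := rfl

end Def416Data

end Literature.NumberTheory.Automorphic.Liu2021.Sec42AlbaneseUnitaryShimuraI

end
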